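import Literature.MathematicalPhysics.QuantumFieldTheory.Balaban1983to89.Node00.CarriersB8SubDPer
import Literature.MathematicalPhysics.QuantumFieldTheory.Balaban1983to89.B8TowerBondsPrinted
import Literature.MathematicalPhysics.QuantumFieldTheory.Balaban1983to89.B8Eq156KLevelLocal

/-!
# `Balaban1983to89.B8Eq15ClassGraphConnectedZd` — [Balaban1985RegularSpaces] (1.3)–(1.6) p. 77, (1.31) p. 82: PRINT'S MULTI-LEVEL CONSTRAINT-BOND GRAPH OF A
# NESTED TOWER IS CONNECTED — class-bond invariance of the block averages of a site function on `ℤᵈ` forces ONE constant on every constraint label of every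
# level (the combinatorial half of [Balaban1985BackgroundPropagators] Theorem 3.11's kernel at a flat background for a GENERAL nested member, truncation `m`)

statement-level skeleton of published theorems with citation tags; proofs where landed; nothing here is a claim about the Yang–Mills mass gap

`[Balaban1985RegularSpaces]` ("B8") = T. Bałaban, *Spaces of regular gauge field configurations on a lattice and gauge fixing conditions*, Commun. Math. Phys.
**99** (1985) 75–102: p. 77 (1.3) «Ω₀ ⊃ Ω₁ ⊃ … ⊃ Ω_k», (1.4) «Ω_j = Bʲ(Ω_j^{(j)}), Ω_j is a sum of cubes of a size M₁Lʲη, (Lʲη)⁻¹dist(Ω_jᶜ, Ω_{j+1}) > RM₁», (1.5)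
«Λ_j = Ω_j^{(j)} ∖ Ω_{j+1}^{(j)}, Λ_k = Ω_k^{(k)}», (1.6) «⋃_j B^j(Λ_j) = Ω», p. 77 «we admit the case where some domains Ω_j are equal to T_η», (1.12) p. 78 («𝔅_k»),
(1.31) p. 82 (the averaging constraints: inner bonds `⟨x, x′⟩ ⊂ Λ_j` AND crossing bonds «b₋ ∈ Λ_j, Γ_{b₋,x} ⊂ Λ_{j−1}»), (1.68) p. 88 (truncations).
`[Balaban1985BackgroundPropagators]` ("B9", CMP **99** (1985) 389–434): Thm 3.11 p. 416 («Δ_a … positive definite»), (3.115) p. 418 «Q_j d = D_j Q′_j», (3.19) p. 393.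
`[Balaban1985Averaging]` ("B7", CMP **98**): (2)–(3) p. 17 (nested blocks), (78) p. 30, (212) p. 50 (the flat block mean `Q′_j`).  `[Balaban1984PropagatorsII]` (2.3) p. 224.

CITATION HEADER (lean-in-tree rule).  Cell `pub-ymgap` (YM Track A, HUMAN RULING D-0062), node N06 = [B9]; seat `pub-ymgap-dag-n06-b` (g25), junction ∕ letter lineage of
J-N06→N05 and owner of the N06 object layer of the (β′-PERIODIC) road; own take of the lineage's open successor item (HANDOFF §2r (b)).  WHY.  The N05 witness slot of
record (`…N05SubBP2DK2PerKappaSlotExistsOfBindersLettersPer(Door)`) displays NODE N06's five analytic binders `InvAtHIPer ∕ GlobAtIPer ∕ HolderAtIH2Per ∕ SrcAtIPer ∕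
SrcHolderAtIH2Per` at EVERY member `a : IdxB8SubDPerκ` of print's nested periodic class with the bond class `towerBondsP θ.L a.Ω (a.Λs k)`; the lineage inhabits them at the
all-torus member `torusIdx` only (p655348 ∕ p656952 ∕ p662241 ∕ p663900), because the first link of that chain — g23's flat-holonomy VECTOR kernel
`B9Thm311FlatHolonomyKernelZdPer.eq_zero_of_flat_holonomy_kernel` — uses that at the all-torus class EVERY level-`m` bond is a constraint bond, so that «`Q_m(1)Ã ≡ 0`» makes
the block sums of the potential `λ̃` constant on all of `ℤᵈ`.  At a nested member the constraint «`Q_j(U₀)A = 0`» holds only on print's class (1.31) — inner bonds of `Λ_j` and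
crossing bonds across `∂Ω_j` — at the levels `j ≤ m`, and the conclusion the kernel argument needs is «`Q′_j(1)λ̃ ≡ c` on `Λ_j` for ALL `j ≤ m`, ONE constant `c`».  THIS FILE proves
exactly that combinatorial statement from (1.3)–(1.6) alone: the blocks `Bʲ(y)`, `y ∈ Λ_j`, `j ≤ m`, partition `ℤᵈ`; two blocks containing the two ends of a unit step are equal,
or an inner pair, or — across `∂Ω_{n+1}`, by the collar of (1.4) («RM₁ ≥ L», the tree's `DomainSeq.sep`) — a level-`(n+1)` block next to a whole `(n+1)`-position of level-`n`
blocks, i.e. a CROSSING bond of (1.31), whose position average is the common average of its sub-blocks; so «average of the block through `x`» has zero steps on `ℤᵈ`.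

WHAT IS PROVED (kernel, 0 sorry; theorems only (+ two private plumbing lemmas); no `def`, no `instance`, no `notation`).
* §0 `eq_corner_of_forall_step_eq_on_box` (a function on a box invariant under in-box unit steps is constant on the box), `under_one_of_block_le` ∕ `inBox_block_of_under_one` ∕
  `mem_blockSites_iff_under_one` (the `L`-block of a label in print's box form), `blockMap_blockMap_pow`, `blockMap_add_e_eq_or`.
* §1 ★ `exists_const_of_cover_of_step` (COVERING LEMMA: blocks covering `ℤᵈ` whose values agree on shared sites and along unit steps carry one value).
* §2 (geometry of print's level sets `B11Eq7Convention.Lam L Ω m` under `DomainSeq`) `mem_layer_of_under_of_mem_lamK` ∕ `mem_of_under_of_mem_lamK` ∕ `not_mem_succ_of_under_of_mem_lamK`,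
  `level_eq_of_mem_layer` (layers disjoint), `exists_lamK_under` ((1.6) at truncation `m`), `abs_e_le_pow`, ★ `adjacent_levels` (adjacent blocks differ by at most one level, and
  only across `∂Ω_{n+1}`), ★★ `collar_block` ∕ `collar_subLabel` (THE COLLAR: the `(n+1)`-position through an exterior neighbour of `Ω_{n+1}` lies in `Ω_n ∖ Ω_{n+1}`, its `L`
  sub-labels are level-`n` constraint labels — print's «Γ_{b₋,x} ⊂ Λ_{j−1}»), `inner_mem_towerBondsP_of_lamK` (an inner pair of labels IS a class bond: box law from (1.6)).
* §3 `sum_blockSites_pow_succ`, `avg_succ_eq_of_forall_avg_eq` (the average one level up), ★ `sum_eq_sum_of_sub_position` (constancy on a position from its inner bonds),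
  `avg_succ_position_eq`.
* §4 ★★★ `exists_const_avg_of_towerBondsP` — THE THEOREM: `DomainSeq L Ω`, `Ω 0 = ℤᵈ`, `Λ l = Lam L Ω m l` (`l ≤ m`), `λ : ℤᵈ → V` (any real vector space) with level-`j` block
  sums equal at the two ends of every bond of `towerBondsP L Ω Λ j`, `j ≤ m` ⟹ `∃ a, ∀ j ≤ m, ∀ y ∈ Λ j, L^{−jd} Σ_{x ∈ Bʲ(y)} λ(x) = a`.
* §5 ★★ `IdxB8SubD.exists_const_avg_of_towerBondsP` ∕ `IdxB8SubDPer.exists_const_avg_of_towerBondsP` — the same at every member of the (1.5)-obeying index of record and of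
  its periodic twin, every truncation `m ≤ k` (rigidity `B8IdxB8SubDRigidity.IdxB8SubD.Λs_eq_lam`).

HONEST SCOPE.  (i) Lattice combinatorics only — NO analysis, no estimate, no operator; nothing of [Balaban1985RegularSpaces] ∕ [Balaban1985BackgroundPropagators] beyond the
typed geometry is asserted; the analytic use (Theorem 3.11's kernel at a flat background of a nested member, then the binders) is the successor file
`B9Thm311FlatHolonomyKernelZdPerNested`.  (ii) Count-neutral (`--supports` the K1 item of record); N05 ∕ N06 NOT discharged; K1⁹ NOT closed; counts UNMOVED; one finite `𝕋⁴`
programme at fixed `ε`, Bałaban as printed; nothing continuum ∕ ℝ⁴ ∕ OS ∕ mass gap ∕ Clay.  Unit `pub-ymgap-dag-n06-b` (g25), 2026-08-28; NEW file importing dag-n05-w1's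
`Node00.CarriersB8SubDPer`, dag-n05-d's `B8TowerBondsPrinted`, `B8Eq156KLevelLocal`; modifies nothing.  Net new unproved facts: 0.
-/

noncomputable section

open scoped BigOperators

namespace Literature.MathematicalPhysics.QuantumFieldTheory.Balaban1983to89.B8Eq15ClassGraphConnectedZd

open Literature.MathematicalPhysics.QuantumLattice (blockSites blockMap mem_blockSites_iff card_blockSites)
open B7Prop1Explicit B7Prop1Local
open B8Ineq130 (tlo thi)
open B8Ineq132 (Under layer)
open B8Thm2LogB (blockTop)
open B8ConstraintBonds (DomainSeq)
open B8TowerBondsPrinted (towerBondsP inner_mem_towerBondsP crossing_mem_towerBondsP crossingMirror_mem_towerBondsP)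
open B8LeafModelZd (ZdIdx)
open B8Eq191FlatLettersCubeMember (under_iff_blockMap_eq)
open B11Eq7Convention (blockMap_eq_of_under under_loK_self mem_iff_of_under)
open B8IdxB8SubDRigidity (loK_mem_layer_iff_of_under loK_eq_smul)
open B8CubeMemberZd (under_smul_iff)
open Node00 (Stage3Params IdxB8SubD IdxB8SubDPer)

-- `Site` alone could resolve to the torus sites of `Setup.lean`; re-export the `ℤ^d` sites of `B7Prop1Explicit`.
export B7Prop1Explicit (Site)

variable {d : ℕ}

/-! ## §0  Lattice plumbing: functions with zero steps are constant (on `ℤᵈ`, on a box); the `L`-block of a label -/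

section Lattice

/-- A function on `ℤᵈ` invariant under every unit step is constant (`ℤᵈ` is connected by unit steps: `x = disp (treeWord x)`; a private copy of
`B9Thm311FlatHolonomyKernelZdPer.eq_of_forall_step_eq`, to keep this module's import closure inside [B8]). [cite: Balaban1985Averaging, p.24 (the tree contours `Γ_{y,x}`; bookkeeping)] -/
private theorem eq_of_forall_step_eq {β : Sort*} (f : Site d → β) (h : ∀ (x : Site d) (κ : Fin d), f (x + e κ) = f x) (x : Site d) : f x = f 0 := by
  have hw : ∀ (w : List (Letter d)) (z : Site d), f (z + disp w) = f z := by
    intro w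
    induction w with
    | nil => intro z; rw [disp_nil, add_zero]
    | cons l w ih =>
      intro z
      rw [disp_cons, ← add_assoc, ih]
      obtain ⟨κ, b⟩ := l
      cases b
      · have h1 := h (z + Letter.vec (κ, false)) κ
        rw [Letter.vec_false, neg_add_cancel_right] at h1
        rw [Letter.vec_false, ← h1]
      · rw [Letter.vec_true, h]
  have := hw (treeWord x) 0
  rwa [disp_treeWord, zero_add] at this

/-- **A function on a lattice box invariant under every unit step INSIDE the box is constant on the box** (every site of `[lo, hi]` is reached from the
corner `lo` by unit steps inside the box; induction on `Σ_i (w_i − lo_i)`). [cite: Balaban1985RegularSpaces, (1.31) p.82 (the inner bonds of one block; bookkeeping)] -/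
theorem eq_corner_of_forall_step_eq_on_box {β : Sort*} (f : Site d → β) (lo hi : Site d)
    (h : ∀ (w : Site d) (i : Fin d), InBox lo hi w → InBox lo hi (w + e i) → f (w + e i) = f w)
    {w : Site d} (hw : InBox lo hi w) : f w = f lo := by
  suffices H : ∀ (n : ℕ) (w : Site d), InBox lo hi w → ∑ i, (w i - lo i) = (n : ℤ) → f w = f lo by
    have hnn : 0 ≤ ∑ i, (w i - lo i) := Finset.sum_nonneg fun i _ => by linarith [(hw i).1]
    exact H (∑ i, (w i - lo i)).toNat w hw (Int.toNat_of_nonneg hnn).symm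
  intro n
  induction n with
  | zero =>
    intro w hw hs
    have hz : ∀ i ∈ Finset.univ, w i - lo i = 0 :=
      (Finset.sum_eq_zero_iff_of_nonneg fun i _ => by linarith [(hw i).1]).1 (by exact_mod_cast hs)
    have : w = lo := funext fun i => by linarith [hz i (Finset.mem_univ i)]
    rw [this]
  | succ n ih =>
    intro w hw hs
    obtain ⟨i, hlt⟩ : ∃ i, lo i < w i := by
      by_contra hcon
      push Not at hcon
      have : ∑ i, (w i - lo i) ≤ 0 := Finset.sum_nonpos fun i _ => by linarith [hcon i]
      rw [hs] at this
      push_cast at this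
      linarith
    have hw'box : InBox lo hi (w - e i) := by
      intro i'
      rw [Pi.sub_apply, e_apply]
      split_ifs with h1
      · subst h1; constructor <;> linarith [(hw i').1, (hw i').2]
      · rw [sub_zero]; exact hw i'
    have hww : w - e i + e i = w := sub_add_cancel w (e i)
    have hs' : ∑ i', ((w - e i) i' - lo i') = (n : ℤ) := by
      have h2 : ∑ i', ((w - e i) i' - lo i') = ∑ i', (w i' - lo i') - ∑ i', (e i : Site d) i' := by
        rw [← Finset.sum_sub_distrib]
        exact Finset.sum_congr rfl fun i' _ => by rw [Pi.sub_apply]; ring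
      have h3 : ∑ i', (e i : Site d) i' = 1 := by
        simp only [e_apply, Finset.sum_ite_eq', Finset.mem_univ, if_true]
      rw [h2, h3, hs]
      push_cast
      ring
    rw [← hww, h (w - e i) i hw'box (hww.symm ▸ hw), ih (w - e i) hw'box hs']

/-- The `L`-block of the label `z` in print's box form «`L•z ≤ w ≤ L•z + (L−1)𝟙`» (the hypothesis shape of `B8TowerBondsPrinted.crossing_mem_towerBondsP`) is `Under L 1 z`.
[cite: Balaban1985RegularSpaces, (1.31) p.82 («Γ_{b₋,x} ⊂ Λ_{j−1}», the `L`-block under a level-`j` site; bookkeeping)] -/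
theorem under_one_of_block_le (L : ℕ) {z w : Site d} (h1 : (L : ℤ) • z ≤ w) (h2 : w ≤ (L : ℤ) • z + blockTop L) : Under L 1 z w := by
  intro i
  have a := h1 i
  have b := h2 i
  simp only [Pi.smul_apply, smul_eq_mul, Pi.add_apply, blockTop] at a b
  rw [pow_one]
  constructor <;> linarith

/-- Conversely `Under L 1 z w` puts `w` in the box `[L•z, L•z + (L−1)𝟙]`. [cite: Balaban1985RegularSpaces, (1.31) p.82 (bookkeeping)] -/
theorem inBox_block_of_under_one (L : ℕ) {z w : Site d} (h : Under L 1 z w) : InBox ((L : ℤ) • z) ((L : ℤ) • z + blockTop L) w := by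
  intro i
  obtain ⟨a, b⟩ := h i
  rw [pow_one] at a b
  simp only [Pi.smul_apply, smul_eq_mul, Pi.add_apply, blockTop]
  constructor <;> linarith

/-- `w ∈ blockSites L z ↔ Under L 1 z w` (`L ≥ 1`). [cite: Balaban1985RegularSpaces, (1.6) p.77 (bookkeeping)] -/
theorem mem_blockSites_iff_under_one {L : ℕ} (hL : 1 ≤ L) (z w : Site d) : w ∈ blockSites L z ↔ Under L 1 z w := by
  haveI : NeZero L := ⟨by omega⟩
  rw [mem_blockSites_iff, under_iff_blockMap_eq hL 1 z w, pow_one]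

/-- The label one level up: `blockMap L (blockMap (Lʲ) x) = blockMap (L^{j+1}) x`. [cite: Balaban1985Averaging, (2)–(3) p.17 (nested blocks; bookkeeping)] -/
theorem blockMap_blockMap_pow (L j : ℕ) (x : Site d) : blockMap L (blockMap (L ^ j) x) = blockMap (L ^ (j + 1)) x := by
  rw [B7BlockGeometry.blockMap_blockMap, pow_succ]

/-- A unit step moves the level-`j` label by `0` or `e_κ`. [cite: Balaban1985Averaging, (2)–(3) p.17 (bookkeeping)] -/
theorem blockMap_add_e_eq_or {L : ℕ} (hL : 1 ≤ L) (j : ℕ) (x : Site d) (κ : Fin d) :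
    blockMap (L ^ j) (x + e κ) = blockMap (L ^ j) x ∨ blockMap (L ^ j) (x + e κ) = blockMap (L ^ j) x + e κ := by
  have hM : 0 < L ^ j := pow_pos (by omega) j
  have := B7BlockGeometry.blockMap_add_single_eq_or (L ^ j) hM x κ (l := 1) zero_le_one (by exact_mod_cast hM)
  simpa only [e] using this

end Lattice

/-! ## §1  The abstract covering lemma: block values compatible along unit steps are ONE constant -/

section Cover

/-- **COVERING LEMMA**: a family of blocks `Blk b ⊂ ℤᵈ`, `b ∈ S`, covering `ℤᵈ`, with values `val b` that agree whenever two blocks share a site or contain the two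
ends of a unit step, has ONE value on every inhabited block (the site function `x ↦ val (block ∋ x)` has zero steps, §0).
[cite: Balaban1985RegularSpaces, (1.5)–(1.6) p.77 («⋃_j B^j(Λ_j) = Ω», the partition; bookkeeping)] -/
theorem exists_const_of_cover_of_step {ι : Type*} {β : Sort*} (Blk : ι → Set (Site d)) (S : Set ι) (val : ι → β)
    (hcover : ∀ x : Site d, ∃ b ∈ S, x ∈ Blk b)
    (hsame : ∀ b ∈ S, ∀ b' ∈ S, ∀ x : Site d, x ∈ Blk b → x ∈ Blk b' → val b = val b')
    (hstep : ∀ b ∈ S, ∀ b' ∈ S, ∀ (x : Site d) (κ : Fin d), x ∈ Blk b → x + e κ ∈ Blk b' → val b = val b') :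
    ∃ a, ∀ b ∈ S, (∃ x, x ∈ Blk b) → val b = a := by
  classical
  let g : Site d → β := fun x => val (Classical.choose (hcover x))
  have hg : ∀ x, Classical.choose (hcover x) ∈ S ∧ x ∈ Blk (Classical.choose (hcover x)) := fun x => Classical.choose_spec (hcover x)
  have hgstep : ∀ (x : Site d) (κ : Fin d), g (x + e κ) = g x := fun x κ =>
    (hstep _ (hg x).1 _ (hg (x + e κ)).1 x κ (hg x).2 (hg (x + e κ)).2).symm
  refine ⟨g 0, fun b hb ⟨x, hx⟩ => ?_⟩
  rw [hsame b hb _ (hg x).1 x hx (hg x).2]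
  exact eq_of_forall_step_eq g hgstep x

end Cover

/-! ## §2  Geometry of print's tower at truncation `m` under (1.3)–(1.4): layers, adjacent blocks, the collar across `∂Ω_{n+1}` -/

section Geometry

variable {L : ℕ} {Ω : ℕ → Set (Site d)}

/-- A site of the block of a constraint label `y ∈ Λ_l` (print's level set `B11Eq7Convention.Lam L Ω m l`) lies in the layer `Ω_l ∖ Ω_{l+1}` (just `Ω_m` at the top `l = m`).
[cite: Balaban1985RegularSpaces, (1.3)–(1.6) p.77] -/
theorem mem_layer_of_under_of_mem_lamK (hL : 1 ≤ L) (hΩ : DomainSeq L Ω) {m l : ℕ} {y x : Site d} (hy : y ∈ B11Eq7Convention.Lam L Ω m l)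
    (hx : Under L l y x) : x ∈ layer Ω m l :=
  (loK_mem_layer_iff_of_under hL hΩ (k := m) hx).1 hy

/-- … in particular it lies in `Ω_l` … [cite: Balaban1985RegularSpaces, (1.5)–(1.6) p.77] -/
theorem mem_of_under_of_mem_lamK (hL : 1 ≤ L) (hΩ : DomainSeq L Ω) {m l : ℕ} {y x : Site d} (hy : y ∈ B11Eq7Convention.Lam L Ω m l)
    (hx : Under L l y x) : x ∈ Ω l :=
  (mem_layer_of_under_of_mem_lamK hL hΩ hy hx).1

/-- … and, below the top of the truncation, outside `Ω_{l+1}`. [cite: Balaban1985RegularSpaces, (1.5) p.77 («Λ_j = Ω_j^{(j)} ∖ Ω_{j+1}^{(j)}»)] -/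
theorem not_mem_succ_of_under_of_mem_lamK (hL : 1 ≤ L) (hΩ : DomainSeq L Ω) {m l : ℕ} (hl : l < m) {y x : Site d}
    (hy : y ∈ B11Eq7Convention.Lam L Ω m l) (hx : Under L l y x) : x ∉ Ω (l + 1) :=
  (mem_layer_of_under_of_mem_lamK hL hΩ hy hx).2 hl

/-- **THE LAYERS OF A TRUNCATION ARE DISJOINT**: a site in the layers of levels `l, l′ ≤ m` has `l = l′`. [cite: Balaban1985RegularSpaces, (1.3) p.77, (1.5) p.77] -/
theorem level_eq_of_mem_layer (hΩ : DomainSeq L Ω) {m l l' : ℕ} (hl : l ≤ m) (hl' : l' ≤ m) {x : Site d} (h : x ∈ layer Ω m l)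
    (h' : x ∈ layer Ω m l') : l = l' := by
  by_contra hne
  rcases Nat.lt_or_gt_of_ne hne with hlt | hlt
  · exact h.2 (lt_of_lt_of_le hlt hl') (hΩ.anti_le (Nat.succ_le_of_lt hlt) h'.1)
  · exact h'.2 (lt_of_lt_of_le hlt hl) (hΩ.anti_le (Nat.succ_le_of_lt hlt) h.1)

/-- **EVERY SITE LIES IN THE BLOCK OF A CONSTRAINT LABEL** (`Ω₀ = ℤᵈ`; the deepest `l ≤ m` with `x ∈ Ω_l`, label `= ⌊x∕Lˡ⌋`) — (1.6) at truncation `m`.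
[cite: Balaban1985RegularSpaces, (1.6) p.77 («⋃_j B^j(Λ_j) = Ω»), p.77 («Ω_j = T_η»)] -/
theorem exists_lamK_under (hL : 1 ≤ L) (hΩ : DomainSeq L Ω) (h0 : Ω 0 = Set.univ) (m : ℕ) (x : Site d) :
    ∃ l, l ≤ m ∧ ∃ y ∈ B11Eq7Convention.Lam L Ω m l, Under L l y x := by
  obtain ⟨l, -, hlm, hx⟩ := B8Ineq132.exists_layer (Ω := Ω) (k := m) (j := 0) (v := x) (Nat.zero_le m) (by rw [h0]; exact Set.mem_univ x)
  exact ⟨l, hlm, B8Eq131Cubes.flm L l x, (loK_mem_layer_iff_of_under hL hΩ (B8Eq131Cubes.under_flm hL l x)).2 hx, B8Eq131Cubes.under_flm hL l x⟩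

/-- `|e_κ(i)| ≤ Lⁿ⁺¹` for `L ≥ 1` (the unit step is inside the collar radius of `DomainSeq.sep`). [cite: Balaban1985RegularSpaces, (1.4) p.77 (bookkeeping)] -/
theorem abs_e_le_pow (hL : 1 ≤ L) (κ : Fin d) (n : ℕ) (i : Fin d) : |(e κ : Site d) i| ≤ (L : ℤ) ^ (n + 1) := by
  have h1 : (1 : ℤ) ≤ (L : ℤ) ^ (n + 1) := one_le_pow₀ (by exact_mod_cast hL)
  rw [e_apply]
  split_ifs
  · rw [abs_one]; exact h1
  · rw [abs_zero]; exact le_trans zero_le_one h1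

/-- **ADJACENT BLOCKS OF THE PARTITION DIFFER BY AT MOST ONE LEVEL, AND ONLY ACROSS `∂Ω_{n+1}`**: if `x` lies in the layer of level `l` and `x + e_κ` in that of level
`l′` (`l, l′ ≤ m`), then `l′ = l`, or `l = l′ + 1` with `x + e_κ ∉ Ω_l`, or `l′ = l + 1` with `x ∉ Ω_{l′}` — two levels apart is excluded by the collar (1.4)
«(Lʲη)⁻¹dist(Ω_jᶜ, Ω_{j+1}) > RM₁» (`DomainSeq.sep`). [cite: Balaban1985RegularSpaces, (1.3)–(1.5) p.77] -/
theorem adjacent_levels (hL : 1 ≤ L) (hΩ : DomainSeq L Ω) {m l l' : ℕ} (hl : l ≤ m) (hl' : l' ≤ m) {x : Site d} {κ : Fin d}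
    (h : x ∈ layer Ω m l) (h' : x + e κ ∈ layer Ω m l') :
    l' = l ∨ (l = l' + 1 ∧ x + e κ ∉ Ω l) ∨ (l' = l + 1 ∧ x ∉ Ω l') := by
  rcases lt_trichotomy l' l with hlt | heq | hgt
  · have hl'm : l' < m := lt_of_lt_of_le hlt hl
    have hx'out : x + e κ ∉ Ω (l' + 1) := h'.2 hl'm
    have hle : l = l' + 1 := by
      by_contra hne
      have h2 : l' + 1 + 1 ≤ l := by omega
      exact hx'out (hΩ.sep (l' + 1) x (e κ) (hΩ.anti_le h2 h.1) (abs_e_le_pow hL κ (l' + 1)))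
    subst hle
    exact Or.inr (Or.inl ⟨rfl, hx'out⟩)
  · exact Or.inl heq
  · have hlm : l < m := lt_of_lt_of_le hgt hl'
    have hxout : x ∉ Ω (l + 1) := h.2 hlm
    have hle : l' = l + 1 := by
      by_contra hne
      have h2 : l + 1 + 1 ≤ l' := by omega
      have h3 := hΩ.sep (l + 1) (x + e κ) (-e κ) (hΩ.anti_le h2 h'.1)
        (fun i => by rw [Pi.neg_apply, abs_neg]; exact abs_e_le_pow hL κ (l + 1) i)
      rw [add_neg_cancel_right] at h3
      exact hxout h3
    subst hle
    exact Or.inr (Or.inr ⟨rfl, hxout⟩)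

/-- **THE COLLAR ACROSS `∂Ω_{n+1}`, BLOCK FORM**: if `x ∈ Ω_{n+1}` and a site `x′ ∉ Ω_{n+1}` at sup-distance `≤ 1` from `x` lies in the `(n+1)`-block of the label `z′`, then the
WHOLE block of `z′` lies in `Ω_n ∖ Ω_{n+1}` — (1.4) with `RM₁ ≥ L` (`DomainSeq.sep`: the sup-ball of radius `Lⁿ⁺¹` about `Ω_{n+1}` is in `Ω_n`) and «Ω_{n+1} = Bⁿ⁺¹(Ω_{n+1}^{(n+1)})»
(`DomainSeq.sat`). [cite: Balaban1985RegularSpaces, (1.3)–(1.4) p.77] -/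
theorem collar_block (hΩ : DomainSeq L Ω) {n : ℕ} {x x' z' : Site d} (hx : x ∈ Ω (n + 1)) (hx' : x' ∉ Ω (n + 1))
    (hadj : ∀ i, |x' i - x i| ≤ 1) (hz' : Under L (n + 1) z' x') {v : Site d} (hv : Under L (n + 1) z' v) : v ∈ Ω n ∧ v ∉ Ω (n + 1) := by
  constructor
  · have ht : ∀ i, |(v - x) i| ≤ (L : ℤ) ^ (n + 1) := by
      intro i
      obtain ⟨a1, a2⟩ := hz' i
      obtain ⟨b1, b2⟩ := hv i
      obtain ⟨c1, c2⟩ := abs_le.1 (hadj i)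
      rw [Pi.sub_apply, abs_le]
      constructor <;> nlinarith
    have h1 := hΩ.sep n x (v - x) hx ht
    rwa [add_sub_cancel] at h1
  · intro hvin
    exact hx' (hΩ.sat (n + 1) v x' ((blockMap_eq_of_under hv).trans (blockMap_eq_of_under hz').symm) hvin)

/-- **THE COLLAR, LABEL FORM**: in the situation of `collar_block`, every label `w` of the `L`-block under `z′` is a level-`n` constraint label of EVERY truncation
`m` (its corner lies in `Ω_n ∖ Ω_{n+1}`) — the `L`-block «Γ_{b₋,x} ⊂ Λ_{j−1}» of print's crossing bond (1.31). [cite: Balaban1985RegularSpaces, (1.31) p.82, (1.3)–(1.5) p.77] -/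
theorem collar_subLabel (hL : 1 ≤ L) (hΩ : DomainSeq L Ω) {n : ℕ} {x x' z' : Site d} (hx : x ∈ Ω (n + 1)) (hx' : x' ∉ Ω (n + 1))
    (hadj : ∀ i, |x' i - x i| ≤ 1) (hz' : Under L (n + 1) z' x') {w : Site d} (hw : Under L 1 z' w) (m : ℕ) :
    w ∈ B11Eq7Convention.Lam L Ω m n := by
  have hc : Under L (n + 1) z' (loK L n w) := by
    rw [loK_eq_smul, Nat.add_comm]
    exact (under_smul_iff hL 1 n z' w).2 hw
  obtain ⟨h1, h2⟩ := collar_block hΩ hx hx' hadj hz' hc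
  exact ⟨h1, fun _ => h2⟩

/-- **AN INNER PAIR OF CONSTRAINT LABELS IS A CLASS BOND** ((1.31)₁): for `y, y + e_κ ∈ Λ_l` (print's level set) the bond `(y, κ)` lies in `towerBondsP L Ω Λ l` — its fine box
`Bˡ(y) ∪ Bˡ(y + e_κ)` is in `Ω_l` because both blocks are. [cite: Balaban1985RegularSpaces, (1.31) p.82, (1.5)–(1.6) p.77] -/
theorem inner_mem_towerBondsP_of_lamK (hL : 1 ≤ L) (hΩ : DomainSeq L Ω) {m l : ℕ} {Λ : ℕ → Set (Site d)} (hΛ : Λ l = B11Eq7Convention.Lam L Ω m l)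
    {y : Site d} {κ : Fin d} (hy : y ∈ Λ l) (hy' : y + e κ ∈ Λ l) : (y, κ) ∈ towerBondsP L Ω Λ l := by
  refine inner_mem_towerBondsP L (fun v hv => ?_) hy hy'
  rw [hΛ] at hy hy'
  rcases B8Eq156KLevelLocal.blockMap_of_inBox_loK hL l y κ hv with h | h
  · exact mem_of_under_of_mem_lamK hL hΩ hy ((under_iff_blockMap_eq hL l _ v).2 h)
  · exact mem_of_under_of_mem_lamK hL hΩ hy' ((under_iff_blockMap_eq hL l _ v).2 h)

end Geometry

/-! ## §3  Block sums and block averages: one level up; constancy on a position whose `L`-block consists of constraint labels -/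

section Sums

variable {V : Type*} [AddCommGroup V] [Module ℝ V] {L : ℕ} {Ω : ℕ → Set (Site d)}

omit [Module ℝ V] in
/-- `Σ_{x ∈ Bⁿ⁺¹(z)} λ(x) = Σ_{w ∈ B(z)} Σ_{x ∈ Bⁿ(w)} λ(x)` (nested blocks). [cite: Balaban1985Averaging, (2)–(3) p.17 (nested blocks)] -/
theorem sum_blockSites_pow_succ (hL : 1 ≤ L) (lam : Site d → V) (n : ℕ) (z : Site d) :
    ∑ x ∈ blockSites (L ^ (n + 1)) z, lam x = ∑ w ∈ blockSites L z, ∑ x ∈ blockSites (L ^ n) w, lam x := by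
  rw [pow_succ]
  exact B7BlockGeometry.sum_blockSites_mul (L ^ n) L (pow_pos (by omega) n) (by omega) z lam

/-- **THE AVERAGE ONE LEVEL UP**: if the level-`n` block averages `L^{−nd}Σ_{Bⁿ(w)}λ` of all `Lᵈ` sub-labels `w` of `z` equal `a`, the level-`(n+1)` block average
`L^{−(n+1)d}Σ_{Bⁿ⁺¹(z)}λ` equals `a` («Q′_{j+1} = Q′Q′_j» at `U = 1`). [cite: Balaban1985Averaging, (212) p.50, (78) p.30; Balaban1985BackgroundPropagators, (3.19) p.393] -/
theorem avg_succ_eq_of_forall_avg_eq (hL : 1 ≤ L) (lam : Site d → V) {n : ℕ} {z : Site d} {a : V}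
    (h : ∀ w ∈ blockSites L z, ((L : ℝ) ^ (n * d))⁻¹ • ∑ x ∈ blockSites (L ^ n) w, lam x = a) :
    ((L : ℝ) ^ ((n + 1) * d))⁻¹ • ∑ x ∈ blockSites (L ^ (n + 1)) z, lam x = a := by
  have hLpos : (0 : ℝ) < L := by exact_mod_cast (show 0 < L by omega)
  have hpow : ((L : ℝ) ^ (n * d)) ≠ 0 := pow_ne_zero _ hLpos.ne'
  have h' : ∀ w ∈ blockSites L z, ∑ x ∈ blockSites (L ^ n) w, lam x = ((L : ℝ) ^ (n * d)) • a := by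
    intro w hw
    rw [← h w hw, smul_smul, mul_inv_cancel₀ hpow, one_smul]
  rw [sum_blockSites_pow_succ hL lam n z, Finset.sum_congr rfl h', Finset.sum_const, card_blockSites, ← Nat.cast_smul_eq_nsmul ℝ,
    smul_smul, smul_smul]
  have hs : ((L : ℝ) ^ ((n + 1) * d))⁻¹ * ((L ^ d : ℕ) : ℝ) * (L : ℝ) ^ (n * d) = 1 := by
    push_cast
    rw [mul_assoc, ← pow_add, show d + n * d = (n + 1) * d by ring, inv_mul_cancel₀ (pow_ne_zero _ hLpos.ne')]
  rw [hs, one_smul]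

omit [Module ℝ V] in
/-- **CONSTANCY ON A POSITION**: if every label of the `L`-block under `z` is a level-`n` constraint label (print's level set, read through `Λ n`) and the level-`n`
block sums are invariant along the class bonds of `towerBondsP L Ω Λ n`, then all `Lᵈ` sub-labels of `z` carry the same block sum — the unit steps inside the
`L`-block are INNER class bonds (§2), and a box is connected by unit steps (§0). [cite: Balaban1985RegularSpaces, (1.31) p.82, (1.5)–(1.6) p.77] -/
theorem sum_eq_sum_of_sub_position (hL : 1 ≤ L) (hΩ : DomainSeq L Ω) {m n : ℕ} {Λ : ℕ → Set (Site d)} (hΛ : Λ n = B11Eq7Convention.Lam L Ω m n)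
    (lam : Site d → V)
    (hinv : ∀ c ∈ towerBondsP L Ω Λ n, ∑ x ∈ blockSites (L ^ n) (c.1 + e c.2), lam x = ∑ x ∈ blockSites (L ^ n) c.1, lam x)
    {z : Site d} (hz : ∀ w, Under L 1 z w → w ∈ Λ n) {w : Site d} (hw : Under L 1 z w) {w₀ : Site d} (hw₀ : Under L 1 z w₀) :
    ∑ x ∈ blockSites (L ^ n) w, lam x = ∑ x ∈ blockSites (L ^ n) w₀, lam x := by
  have key : ∀ u, Under L 1 z u → ∑ x ∈ blockSites (L ^ n) u, lam x = ∑ x ∈ blockSites (L ^ n) ((L : ℤ) • z), lam x := by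
    intro u hu
    refine eq_corner_of_forall_step_eq_on_box (fun u => ∑ x ∈ blockSites (L ^ n) u, lam x) ((L : ℤ) • z) ((L : ℤ) • z + blockTop L)
      (fun u i hu1 hu2 => ?_) (inBox_block_of_under_one L hu)
    have hu1' := hz u (under_one_of_block_le L (fun i => (hu1 i).1) (fun i => (hu1 i).2))
    have hu2' := hz (u + e i) (under_one_of_block_le L (fun i => (hu2 i).1) (fun i => (hu2 i).2))
    exact hinv (u, i) (inner_mem_towerBondsP_of_lamK hL hΩ hΛ hu1' hu2')
  rw [key w hw, key w₀ hw₀]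

/-- **THE AVERAGE OF A CROSSING POSITION**: in the situation of `sum_eq_sum_of_sub_position`, the level-`(n+1)` block average of `z` equals the level-`n` block average of
ANY of its sub-labels `w₀`. [cite: Balaban1985RegularSpaces, (1.31) p.82; Balaban1985Averaging, (212) p.50] -/
theorem avg_succ_position_eq (hL : 1 ≤ L) (hΩ : DomainSeq L Ω) {m n : ℕ} {Λ : ℕ → Set (Site d)} (hΛ : Λ n = B11Eq7Convention.Lam L Ω m n)
    (lam : Site d → V)
    (hinv : ∀ c ∈ towerBondsP L Ω Λ n, ∑ x ∈ blockSites (L ^ n) (c.1 + e c.2), lam x = ∑ x ∈ blockSites (L ^ n) c.1, lam x)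
    {z : Site d} (hz : ∀ w, Under L 1 z w → w ∈ Λ n) {w₀ : Site d} (hw₀ : Under L 1 z w₀) :
    ((L : ℝ) ^ ((n + 1) * d))⁻¹ • ∑ x ∈ blockSites (L ^ (n + 1)) z, lam x = ((L : ℝ) ^ (n * d))⁻¹ • ∑ x ∈ blockSites (L ^ n) w₀, lam x :=
  avg_succ_eq_of_forall_avg_eq hL lam fun w hw => by
    rw [sum_eq_sum_of_sub_position hL hΩ hΛ lam hinv hz ((mem_blockSites_iff_under_one hL z w).1 hw) hw₀]

end Sums

/-! ## §4  THE THEOREM: class-bond invariance of the block sums forces ONE constant block average on every constraint label of every level -/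

section Main

variable {V : Type*} [AddCommGroup V] [Module ℝ V] {L : ℕ} {Ω : ℕ → Set (Site d)}

/-- ★★★ **PRINT'S MULTI-LEVEL CONSTRAINT GRAPH IS CONNECTED** ([Balaban1985RegularSpaces] (1.3)–(1.5), (1.31)): let `Ω₀ = ℤᵈ ⊃ Ω₁ ⊃ … ` obey (1.3)–(1.4) (`DomainSeq`:
nested, `Ω_j = Bʲ(Ω_j^{(j)})`, the collar of (1.4) with `RM₁ ≥ L`), let `Λ l` (`l ≤ m`) be print's level sets (1.5) of the truncation `{Ω_j}_{j ≤ m}` (`Λ_l = Ω_l^{(l)} ∖ Ω_{l+1}^{(l)}`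
for `l < m`, `Λ_m = Ω_m^{(m)}`; `B11Eq7Convention.Lam`), and let `λ : ℤᵈ → V` be a site function whose level-`j` BLOCK SUMS take the same value at the two ends of EVERY bond of
print's class `towerBondsP L Ω Λ j` — inner bonds «⟨y, y′⟩ ⊂ Λ_j» AND crossing bonds «b₋ ∈ Λ_j, Γ_{b₋,x} ⊂ Λ_{j−1}» — for every `j ≤ m`.  THEN there is ONE vector `a` with
`L^{−jd} Σ_{x ∈ Bʲ(y)} λ(x) = a` for every `j ≤ m` and every `y ∈ Λ_j`.  ROUTE: the blocks `Bʲ(y)`, `y ∈ Λ_j`, `j ≤ m`, partition `ℤᵈ` ((1.6)); two blocks sharing the ends of a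
unit step are either equal, or an inner pair (same level, (1.31)₁), or — across `∂Ω_{n+1}`, by the collar — a level-`(n+1)` block next to a whole `(n+1)`-position of level-`n`
blocks, which is a crossing bond ((1.31)₂) whose position average is the common average of its sub-blocks (§3); so the site function «average of the block through `x`»
has zero steps (§1).  This is the combinatorial half of [Balaban1985BackgroundPropagators] Theorem 3.11's kernel («Q_j(U₀)A = 0 on 𝔅 ⟹ Q′_jλ ≡ const») at a GENERAL nested
member; the all-torus member is the case `Ω_j = ℤᵈ`, where every level-`m` bond is inner.
[cite: Balaban1985RegularSpaces, (1.3)–(1.6) p.77, (1.31) p.82, (1.12) p.78; Balaban1985BackgroundPropagators, (3.115) p.418, Thm 3.11 p.416; Balaban1984PropagatorsII, (2.3) p.224] -/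
theorem exists_const_avg_of_towerBondsP (hL : 1 ≤ L) (hΩ : DomainSeq L Ω) (h0 : Ω 0 = Set.univ) (m : ℕ) {Λ : ℕ → Set (Site d)}
    (hΛ : ∀ l, l ≤ m → Λ l = B11Eq7Convention.Lam L Ω m l) (lam : Site d → V)
    (hinv : ∀ j, j ≤ m → ∀ c ∈ towerBondsP L Ω Λ j,
      ∑ x ∈ blockSites (L ^ j) (c.1 + e c.2), lam x = ∑ x ∈ blockSites (L ^ j) c.1, lam x) :
    ∃ a : V, ∀ j, j ≤ m → ∀ y ∈ Λ j, ((L : ℝ) ^ (j * d))⁻¹ • ∑ x ∈ blockSites (L ^ j) y, lam x = a := by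
  -- the blocks of the partition, their index set, their values
  let Blk : ℕ × Site d → Set (Site d) := fun b => {x | Under L b.1 b.2 x}
  let S : Set (ℕ × Site d) := {b | b.1 ≤ m ∧ b.2 ∈ Λ b.1}
  let val : ℕ × Site d → V := fun b => ((L : ℝ) ^ (b.1 * d))⁻¹ • ∑ x ∈ blockSites (L ^ b.1) b.2, lam x
  have hmemL : ∀ {l : ℕ} {y : Site d}, l ≤ m → y ∈ Λ l → y ∈ B11Eq7Convention.Lam L Ω m l := fun hl hy => by rwa [hΛ _ hl] at hy
  -- (cover)
  have hcover : ∀ x : Site d, ∃ b ∈ S, x ∈ Blk b := by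
    intro x
    obtain ⟨l, hl, y, hy, hx⟩ := exists_lamK_under hL hΩ h0 m x
    exact ⟨(l, y), ⟨hl, by rwa [hΛ l hl]⟩, hx⟩
  -- (same site)
  have hsame : ∀ b ∈ S, ∀ b' ∈ S, ∀ x : Site d, x ∈ Blk b → x ∈ Blk b' → val b = val b' := by
    rintro ⟨l, y⟩ ⟨hl, hy⟩ ⟨l', y'⟩ ⟨hl', hy'⟩ x hx hx'
    have hll : l = l' := level_eq_of_mem_layer hΩ hl hl' (mem_layer_of_under_of_mem_lamK hL hΩ (hmemL hl hy) hx)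
      (mem_layer_of_under_of_mem_lamK hL hΩ (hmemL hl' hy') hx')
    subst hll
    have hyy : y = y' := (blockMap_eq_of_under hx).symm.trans (blockMap_eq_of_under hx')
    subst hyy
    rfl
  -- (unit step)
  have hstep : ∀ b ∈ S, ∀ b' ∈ S, ∀ (x : Site d) (κ : Fin d), x ∈ Blk b → x + e κ ∈ Blk b' → val b = val b' := by
    rintro ⟨l, y⟩ ⟨hl, hy⟩ ⟨l', y'⟩ ⟨hl', hy'⟩ x κ hx hx'
    change Under L l y x at hx
    change Under L l' y' (x + e κ) at hx'
    change ((L : ℝ) ^ (l * d))⁻¹ • ∑ x ∈ blockSites (L ^ l) y, lam x = ((L : ℝ) ^ (l' * d))⁻¹ • ∑ x ∈ blockSites (L ^ l') y', lam x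
    have hyx : blockMap (L ^ l) x = y := blockMap_eq_of_under hx
    have hy'x : blockMap (L ^ l') (x + e κ) = y' := blockMap_eq_of_under hx'
    have hlay := mem_layer_of_under_of_mem_lamK hL hΩ (hmemL hl hy) hx
    have hlay' := mem_layer_of_under_of_mem_lamK hL hΩ (hmemL hl' hy') hx'
    rcases adjacent_levels hL hΩ hl hl' hlay hlay' with hll | ⟨hll, hout⟩ | ⟨hll, hout⟩
    · -- same level: equal labels or an inner bond
      subst hll
      rcases blockMap_add_e_eq_or hL l' x κ with h1 | h1
      · rw [hy'x, hyx] at h1; rw [h1]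
      · rw [hy'x, hyx] at h1
        subst h1
        rw [hinv l' hl' (y, κ) (inner_mem_towerBondsP_of_lamK hL hΩ (hΛ l' hl') hy hy')]
    · -- `x ∈ Ω_l` one level above `x + e_κ`: the position `y + e_κ` is a mirrored crossing partner of `y`
      subst hll
      have hpos : blockMap (L ^ (l' + 1)) (x + e κ) = y + e κ := by
        rcases blockMap_add_e_eq_or hL (l' + 1) x κ with h1 | h1
        · exact absurd (mem_of_under_of_mem_lamK hL hΩ (hmemL hl hy) ((under_iff_blockMap_eq hL _ _ _).2 (h1.trans hyx))) hout
        · rw [h1, hyx]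
      have hz' : Under L (l' + 1) (y + e κ) (x + e κ) := (under_iff_blockMap_eq hL _ _ _).2 hpos
      have hadj : ∀ i, |(x + e κ) i - x i| ≤ 1 := fun i => by
        rw [Pi.add_apply, add_sub_cancel_left]; exact (abs_e_le_pow (L := 1) le_rfl κ 0 i).trans (by norm_num)
      have hsub : ∀ w, Under L 1 (y + e κ) w → w ∈ Λ l' := fun w hw => by
        rw [hΛ l' hl']; exact collar_subLabel hL hΩ hlay.1 hout hadj hz' hw m
      have hbond : (y, κ) ∈ towerBondsP L Ω Λ (l' + 1) := by
        refine crossingMirror_mem_towerBondsP L (fun v hv => ?_) hy (fun w h1 h2 => hsub w (under_one_of_block_le L h1 h2))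
        rcases B8Eq156KLevelLocal.blockMap_of_inBox_loK hL (l' + 1) y κ hv with h1 | h1
        · exact hΩ.anti l' (mem_of_under_of_mem_lamK hL hΩ (hmemL hl hy) ((under_iff_blockMap_eq hL _ _ v).2 h1))
        · exact (collar_block hΩ hlay.1 hout hadj hz' ((under_iff_blockMap_eq hL _ _ v).2 h1)).1
      have hw₀ : Under L 1 (y + e κ) y' := by
        rw [under_iff_blockMap_eq hL 1, pow_one, ← hy'x, blockMap_blockMap_pow, hpos]
      rw [← hinv (l' + 1) hl (y, κ) hbond]
      exact avg_succ_position_eq hL hΩ (hΛ l' hl') lam (hinv l' hl') hsub hw₀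
    · -- `x + e_κ ∈ Ω_{l′}` one level above `x`: the position `y′ − e_κ ∋ x` is a crossing partner of `y′`
      subst hll
      set z : Site d := blockMap (L ^ (l + 1)) x with hzdef
      have hz : Under L (l + 1) z x := (under_iff_blockMap_eq hL _ _ _).2 rfl
      have hpos : y' = z + e κ := by
        rcases blockMap_add_e_eq_or hL (l + 1) x κ with h1 | h1
        · exact absurd (mem_of_under_of_mem_lamK hL hΩ (hmemL hl' hy') ((under_iff_blockMap_eq hL _ _ _).2 (h1.symm.trans hy'x))) hout
        · rw [← hy'x, h1]
      have hadj : ∀ i, |x i - (x + e κ) i| ≤ 1 := fun i => by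
        rw [Pi.add_apply, sub_add_cancel_left, abs_neg]; exact (abs_e_le_pow (L := 1) le_rfl κ 0 i).trans (by norm_num)
      have hsub : ∀ w, Under L 1 z w → w ∈ Λ l := fun w hw => by
        rw [hΛ l hl]; exact collar_subLabel hL hΩ hlay'.1 hout hadj hz hw m
      have hbond : (z, κ) ∈ towerBondsP L Ω Λ (l + 1) := by
        refine crossing_mem_towerBondsP L (fun v hv => ?_) (fun w h1 h2 => hsub w (under_one_of_block_le L h1 h2)) (hpos ▸ hy')
        rcases B8Eq156KLevelLocal.blockMap_of_inBox_loK hL (l + 1) z κ hv with h1 | h1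
        · exact (collar_block hΩ hlay'.1 hout hadj hz ((under_iff_blockMap_eq hL _ _ v).2 h1)).1
        · rw [← hpos] at h1
          exact hΩ.anti l (mem_of_under_of_mem_lamK hL hΩ (hmemL hl' hy') ((under_iff_blockMap_eq hL _ _ v).2 h1))
      have hw₀ : Under L 1 z y := by
        rw [under_iff_blockMap_eq hL 1, pow_one, ← hyx, blockMap_blockMap_pow]
      have h2 := hinv (l + 1) hl' (z, κ) hbond
      rw [← hpos] at h2
      rw [h2]
      exact (avg_succ_position_eq hL hΩ (hΛ l hl) lam (hinv l hl) hsub hw₀).symm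
  obtain ⟨a, ha⟩ := exists_const_of_cover_of_step Blk S val hcover hsame hstep
  exact ⟨a, fun j hj y hy => ha (j, y) ⟨hj, hy⟩ ⟨loK L j y, under_loK_self hL j y⟩⟩

end Main

/-! ## §5  On the indices of record: every (1.5)-member `IdxB8SubD θ` ∕ periodic member `IdxB8SubDPer θ P`, every truncation `m ≤ k` -/

section Members

variable {V : Type*} [AddCommGroup V] [Module ℝ V] {θ : Stage3Params}

/-- `1 ≤ θ.L` (Bałaban's `L ≥ 2`; private plumbing). [folklore] -/
private theorem one_le_L (θ : Stage3Params) : 1 ≤ θ.L := le_trans (by norm_num) θ.two_le_L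

/-- ★★ **CONNECTIVITY ON THE (1.5)-OBEYING INDEX OF RECORD**: at every member `j : IdxB8SubD θ` and every truncation `m ≤ k`, class-bond invariance of the level-`l` block sums of
a site function over print's class `towerBondsP θ.L Ω (Λs m) l`, `l ≤ m`, forces one constant block average on every `y ∈ Λs m l`, `l ≤ m` (rigidity `Λs m l = Lam θ.L Ω m l`,
`B8IdxB8SubDRigidity.IdxB8SubD.Λs_eq_lam`, + §4). [cite: Balaban1985RegularSpaces, (1.3)–(1.6) p.77, (1.31) p.82; Balaban1985BackgroundPropagators, Thm 3.11 p.416, (3.115) p.418] -/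
theorem IdxB8SubD.exists_const_avg_of_towerBondsP (j : IdxB8SubD θ) {m : ℕ} (hm : m ≤ j.1.1.1.1.k) (lam : Site θ.D → V)
    (hinv : ∀ l, l ≤ m → ∀ c ∈ towerBondsP θ.L j.1.1.1.1.Ω (j.1.1.1.1.Λs m) l,
      ∑ x ∈ blockSites (θ.L ^ l) (c.1 + e c.2), lam x = ∑ x ∈ blockSites (θ.L ^ l) c.1, lam x) :
    ∃ a : V, ∀ l, l ≤ m → ∀ y ∈ j.1.1.1.1.Λs m l, ((θ.L : ℝ) ^ (l * θ.D))⁻¹ • ∑ x ∈ blockSites (θ.L ^ l) y, lam x = a :=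
  B8Eq15ClassGraphConnectedZd.exists_const_avg_of_towerBondsP (one_le_L θ) j.domainSeq j.Ω_zero m
    (fun _ hl => B8IdxB8SubDRigidity.IdxB8SubD.Λs_eq_lam j hm hl) lam hinv

/-- ★★ **THE SAME ON THE PERIODIC INDEX OF RECORD** `IdxB8SubDPer θ P` (the (β′-PERIODIC) road's members; through `Subtype.val`).
[cite: Balaban1985RegularSpaces, (1.3)–(1.6) p.77, (1.31) p.82, p.77 («Ω_j ⊂ T_η»); Balaban1985BackgroundPropagators, Thm 3.11 p.416, (3.115) p.418] -/
theorem IdxB8SubDPer.exists_const_avg_of_towerBondsP {P : ℕ} (j : IdxB8SubDPer θ P) {m : ℕ} (hm : m ≤ j.1.1.1.1.1.k) (lam : Site θ.D → V)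
    (hinv : ∀ l, l ≤ m → ∀ c ∈ towerBondsP θ.L j.1.1.1.1.1.Ω (j.1.1.1.1.1.Λs m) l,
      ∑ x ∈ blockSites (θ.L ^ l) (c.1 + e c.2), lam x = ∑ x ∈ blockSites (θ.L ^ l) c.1, lam x) :
    ∃ a : V, ∀ l, l ≤ m → ∀ y ∈ j.1.1.1.1.1.Λs m l, ((θ.L : ℝ) ^ (l * θ.D))⁻¹ • ∑ x ∈ blockSites (θ.L ^ l) y, lam x = a :=
  B8Eq15ClassGraphConnectedZd.IdxB8SubD.exists_const_avg_of_towerBondsP j.1 hm lam hinv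

end Members

end Literature.MathematicalPhysics.QuantumFieldTheory.Balaban1983to89.B8Eq15ClassGraphConnectedZd

end
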